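import Summits.ValiantsHypothesis.ValiantsHypothesis.Theorems.BarrierLeverPriorityPeelingMoves

/-!
# Route BarrierLever — the COMPRESSION MOVE for layout determinants (TT, item 19152 / residual 19761)

Library file (`--supports stmt-ValiantsHypothesis-19152`; cell valiant-natproofs, rung V4, 𝒟-side of door (c);
prover gen 8, memo `HOME/prover/gen8/HUB-MEMO-g8.md` §2). It does NOT import the route file.

**Setting** (as in gen 7's `PriorityPeeling.shearMove'`, p459515): a configuration is a family of row index
maps `R i : Fin e → Fin nr` and INJECTIVE column index maps `C j : Fin e → Fin nc` (`i, j : ι`); its layout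
matrix is `(det G[R i, C j])_{ij}`; ALIVE = nonsingular for some `G`.

**The compression move (`compressionMove`).** Fix column literals `x ≠ y`. A column is ELIGIBLE if it hits
`x` (at position `qx j`) and avoids `y`; its IMAGE replaces `x` by `y` in place. An eligible column is
BLOCKED if its image is (up to the order of the slots) another column of the configuration (`partner j`),
otherwise it is MOVED (`aff j`). The COMPRESSED configuration replaces every moved column by its image and
keeps all others (this is the classical compression `C_{x←y}` of extremal set theory; item 19760 /
`shearMove'` is the case without blocked columns — with a blocked column its «sheared configuration» has two
equal columns and is dead, so the old lemma says nothing). CLAIM: if the compressed configuration is alive,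
so is the original one.

**Proof.** Over `ℂ[X]` replace column `x` of a good `G'` by `col x + X · col y` (the matrix of gen 7's
`shear_minor_*` lemmas). In the layout matrix `Ls`, a moved column becomes `C(det) + X · C(det image)`, a
blocked column `j` becomes `C(det) + X · (±C(det partner))` (the image is the partner's set in another slot
order), every other column is constant. Multiply `Ls` on the right by `E = 1 + X · N`, `N` supported on the
entries `(partner j, j)` for blocked `j`: this subtracts `± X · column(partner j)` — a CONSTANT column, the
partner hits `y` — from each blocked column, which becomes constant. Now column `j` of `Ls · E` has
`X`-degree `≤ [aff j]` and the coefficient of `X^{#aff}` in `det (Ls · E)` is the compressed layout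
determinant (`coeff_det_of_natDegree_le_col`), nonzero by hypothesis; hence `det (Ls · E) ≠ 0`, so
`det Ls ≠ 0` (a factor of a nonzero product), and a non-root of `det Ls` gives the witness. `det E` is never
computed.

WHAT THIS IS NOT: one sound move; with the hub lemma (`…Theorems.BarrierLeverHubLemma`) it makes
«compression certificates» for TT layouts checkable, but says nothing on their existence (memo §3–§6), on
TT / TNS / item 19717 in general, on crux stmt-ValiantsHypothesis-14610, or on `VP` versus `VNP`.
-/

-- layout Summits/ValiantsHypothesis/ValiantsHypothesis forces the duplicated namespace component
set_option linter.dupNamespace false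

namespace Summit.ValiantsHypothesis.ValiantsHypothesis.Theorems.BarrierLever.Compression

open Finset Polynomial Matrix PriorityPeeling

variable {nr nc : ℕ}

/-- A minor with the column slots permuted: `det G[ρ, κ ∘ σ] = sign σ · det G[ρ, κ]`. -/
theorem det_submatrix_comp_perm {e : ℕ} (G : Matrix (Fin nr) (Fin nc) ℂ) (ρ : Fin e → Fin nr)
    (κ : Fin e → Fin nc) (σ : Equiv.Perm (Fin e)) :
    (G.submatrix ρ (κ ∘ σ)).det = ((Equiv.Perm.sign σ : ℤˣ) : ℤ) * (G.submatrix ρ κ).det := by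
  have : G.submatrix ρ (κ ∘ σ) = (G.submatrix ρ κ).submatrix id σ := rfl
  rw [this, Matrix.det_permute']

/-- **THE COMPRESSION MOVE** (memo §2; see the module docstring for the data). -/
theorem compressionMove {ι : Type*} [Fintype ι] [DecidableEq ι] {e : ℕ}
    (R : ι → Fin e → Fin nr) (C : ι → Fin e → Fin nc)
    (hC : ∀ j, Function.Injective (C j)) (x y : Fin nc) (hxy : x ≠ y) (aff blk : ι → Bool)
    (qx : ι → Fin e) (partner : ι → ι) (sgn : ι → Equiv.Perm (Fin e))
    (haff : ∀ j, aff j = true → C j (qx j) = x ∧ ∀ q, C j q ≠ y)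
    (hblk : ∀ j, blk j = true → C j (qx j) = x ∧ (∀ q, C j q ≠ y) ∧
      Function.update (C j) (qx j) y = C (partner j) ∘ (sgn j))
    (hdisj : ∀ j, ¬ (aff j = true ∧ blk j = true))
    (hunaff : ∀ j, aff j = false → blk j = false → (∀ q, C j q ≠ x) ∨ (∃ q, C j q = y))
    (hcomp : ∃ G' : Matrix (Fin nr) (Fin nc) ℂ,
      (Matrix.of fun i j : ι => (G'.submatrix (R i)
        (if aff j then Function.update (C j) (qx j) y else C j)).det).det ≠ 0) :
    ∃ G : Matrix (Fin nr) (Fin nc) ℂ,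
      (Matrix.of fun i j : ι => (G.submatrix (R i) (C j)).det).det ≠ 0 := by
  obtain ⟨G', hG'⟩ := hcomp
  set Gs : Matrix (Fin nr) (Fin nc) ℂ[X] := (Matrix.of fun a m =>
    if m = x then Polynomial.C (G' a x) + X * Polynomial.C (G' a y) else Polynomial.C (G' a m))
    with hGs_def
  set Ls : Matrix ι ι ℂ[X] := Matrix.of fun i j : ι => (Gs.submatrix (R i) (C j)).det with hLs_def
  -- constants: original minors d, image minors d'
  set d : ι → ι → ℂ := fun i j => (G'.submatrix (R i) (C j)).det with hd_def
  set d' : ι → ι → ℂ := fun i j => (G'.submatrix (R i) (Function.update (C j) (qx j) y)).det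
    with hd'_def
  -- partners hit y, hence are neither moved nor blocked, and differ from j
  have hpartner_y : ∀ j, blk j = true → ∃ q, C (partner j) q = y := by
    intro j hj
    obtain ⟨-, -, hupd⟩ := hblk j hj
    refine ⟨sgn j (qx j), ?_⟩
    have := congrFun hupd (qx j)
    rw [Function.update_self, Function.comp_apply] at this
    exact this.symm
  have hpartner_aff : ∀ j, blk j = true → aff (partner j) = false := by
    intro j hj
    obtain ⟨q, hq⟩ := hpartner_y j hj
    by_contra h
    exact (haff (partner j) (bool_eq_true_of_not_eq_false h)).2 q hq
  have hpartner_blk : ∀ j, blk j = true → blk (partner j) = false := by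
    intro j hj
    obtain ⟨q, hq⟩ := hpartner_y j hj
    by_contra h
    exact (hblk (partner j) (bool_eq_true_of_not_eq_false h)).2.1 q hq
  have hpartner_ne : ∀ j, blk j = true → partner j ≠ j := by
    intro j hj h
    have := hpartner_blk j hj
    rw [h, hj] at this
    exact Bool.noConfusion this
  -- entries of Ls
  have hentry_aff : ∀ i j, aff j = true →
      Ls i j = Polynomial.C (d i j) + X * Polynomial.C (d' i j) := by
    intro i j hj
    rw [hLs_def, Matrix.of_apply, hGs_def]
    exact shear_minor_affected G' x y (R i) (C j) (hC j) (qx j) (haff j hj).1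
  have hentry_blk : ∀ i j, blk j = true →
      Ls i j = Polynomial.C (d i j) + X * Polynomial.C (d' i j) := by
    intro i j hj
    rw [hLs_def, Matrix.of_apply, hGs_def]
    exact shear_minor_affected G' x y (R i) (C j) (hC j) (qx j) (hblk j hj).1
  have hentry_const : ∀ i j, aff j = false → blk j = false → Ls i j = Polynomial.C (d i j) := by
    intro i j hj hj'
    rw [hLs_def, Matrix.of_apply, hGs_def]
    rcases hunaff j hj hj' with hx | ⟨q₁, hq₁⟩
    · exact shear_minor_const G' x y (R i) (C j) hx
    · by_cases hx : ∃ q, C j q = x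
      · obtain ⟨q₀, hq₀⟩ := hx
        exact shear_minor_neutral G' x y hxy (R i) (C j) (hC j) q₀ q₁ hq₀ hq₁
      · exact shear_minor_const G' x y (R i) (C j) (fun q h => hx ⟨q, h⟩)
  -- the image minor of a blocked column is ± the partner's minor
  have hd'_blk : ∀ i j, blk j = true →
      d' i j = ((Equiv.Perm.sign (sgn j) : ℤˣ) : ℤ) * d i (partner j) := by
    intro i j hj
    show (G'.submatrix (R i) (Function.update (C j) (qx j) y)).det = _ * (G'.submatrix (R i) (C (partner j))).det
    rw [(hblk j hj).2.2]
    exact det_submatrix_comp_perm G' (R i) (C (partner j)) (sgn j)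
  -- the correcting matrix E = 1 + X·N and Ls' := Ls * E
  set cN : ι → ℂ := fun j => -(((Equiv.Perm.sign (sgn j) : ℤˣ) : ℤ) : ℂ) with hcN_def
  set E : Matrix ι ι ℂ[X] := Matrix.of fun k j =>
    (if k = j then (1 : ℂ[X]) else 0) +
      (if blk j = true ∧ k = partner j then X * Polynomial.C (cN j) else 0) with hE_def
  set Ls' : Matrix ι ι ℂ[X] := Ls * E with hLs'_def
  have hLs'_apply : ∀ i j, Ls' i j =
      Ls i j + (if blk j = true then Ls i (partner j) * (X * Polynomial.C (cN j)) else 0) := by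
    intro i j
    rw [hLs'_def, Matrix.mul_apply]
    have hsplit : ∀ k, Ls i k * E k j =
        (if k = j then Ls i k else 0) +
          (if blk j = true ∧ k = partner j then Ls i k * (X * Polynomial.C (cN j)) else 0) := by
      intro k
      rw [hE_def, Matrix.of_apply, mul_add]
      congr 1
      · split_ifs <;> simp
      · split_ifs <;> simp
    rw [Finset.sum_congr rfl fun k _ => hsplit k, Finset.sum_add_distrib, Finset.sum_ite_eq' univ j,
      if_pos (Finset.mem_univ j)]
    congr 1
    by_cases hj : blk j = true
    · rw [if_pos hj]
      have : (fun k => if blk j = true ∧ k = partner j then Ls i k * (X * Polynomial.C (cN j)) else 0) =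
          fun k => if k = partner j then Ls i k * (X * Polynomial.C (cN j)) else 0 := by
        funext k
        by_cases hk : k = partner j
        · rw [if_pos ⟨hj, hk⟩, if_pos hk]
        · rw [if_neg (fun h => hk h.2), if_neg hk]
      rw [this, Finset.sum_ite_eq' univ (partner j), if_pos (Finset.mem_univ _)]
    · rw [if_neg hj]
      refine Finset.sum_eq_zero fun k _ => ?_
      rw [if_neg (fun h => hj h.1)]
  -- entries of Ls'
  have hentry'_aff : ∀ i j, aff j = true →
      Ls' i j = Polynomial.C (d i j) + X * Polynomial.C (d' i j) := by
    intro i j hj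
    have hb : ¬ blk j = true := fun h => hdisj j ⟨hj, h⟩
    rw [hLs'_apply, if_neg hb, add_zero, hentry_aff i j hj]
  have hentry'_blk : ∀ i j, blk j = true → Ls' i j = Polynomial.C (d i j) := by
    intro i j hj
    rw [hLs'_apply, if_pos hj, hentry_blk i j hj,
      hentry_const i (partner j) (hpartner_aff j hj) (hpartner_blk j hj), hd'_blk i j hj, hcN_def]
    simp only [map_mul, map_neg, map_intCast]
    ring
  have hentry'_const : ∀ i j, aff j = false → blk j = false → Ls' i j = Polynomial.C (d i j) := by
    intro i j hj hj'
    have hb : ¬ blk j = true := by rw [hj']; exact Bool.false_ne_true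
    rw [hLs'_apply, if_neg hb, add_zero, hentry_const i j hj hj']
  -- column degrees and top coefficients of Ls'
  have hdeg : ∀ i j, (Ls' i j).natDegree ≤ (if aff j then 1 else 0) := by
    intro i j
    cases hj : aff j
    · by_cases hb : blk j = true
      · rw [hentry'_blk i j hb, natDegree_C]; exact le_rfl
      · have hb' : blk j = false := Bool.eq_false_iff.mpr hb
        rw [hentry'_const i j hj hb', natDegree_C]; exact le_rfl
    · rw [hentry'_aff i j hj]
      show _ ≤ 1
      refine (natDegree_add_le _ _).trans (max_le ((natDegree_C _).le.trans zero_le_one) ?_)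
      exact (natDegree_mul_le).trans (by rw [natDegree_X, natDegree_C])
  have hcoeff : ∀ i j, (Ls' i j).coeff (if aff j then 1 else 0) =
      (G'.submatrix (R i) (if aff j then Function.update (C j) (qx j) y else C j)).det := by
    intro i j
    cases hj : aff j
    · simp only [Bool.false_eq_true, if_false]
      by_cases hb : blk j = true
      · rw [hentry'_blk i j hb, coeff_C_zero]
      · have hb' : blk j = false := Bool.eq_false_iff.mpr hb
        rw [hentry'_const i j hj hb', coeff_C_zero]
    · rw [hentry'_aff i j hj]
      simp only [if_true, coeff_add, coeff_C_succ, coeff_X_mul, coeff_C_zero, zero_add]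
      rfl
  have hLs' : Ls'.det ≠ 0 := by
    intro h0
    have hc := coeff_det_of_natDegree_le_col Ls' (fun j => if aff j then 1 else 0) hdeg
    rw [h0, coeff_zero] at hc
    have hmat : (Matrix.of fun i j => (Ls' i j).coeff (if aff j then 1 else 0)) =
        Matrix.of fun i j : ι => (G'.submatrix (R i)
          (if aff j then Function.update (C j) (qx j) y else C j)).det := by
      refine Matrix.ext (fun i j => ?_)
      rw [Matrix.of_apply, Matrix.of_apply, hcoeff]
    rw [hmat] at hc
    exact hG' hc.symm
  have hLs : Ls.det ≠ 0 := by
    intro h0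
    apply hLs'
    rw [hLs'_def, Matrix.det_mul, h0, zero_mul]
  obtain ⟨t, ht⟩ := exists_eval_ne_zero_of_ne_zero _ hLs
  refine ⟨Gs.map (Polynomial.eval t), ?_⟩
  rw [← Polynomial.coe_evalRingHom, ← map_layoutDet]
  exact ht

end Summit.ValiantsHypothesis.ValiantsHypothesis.Theorems.BarrierLever.Compression
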